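import Summits.AnomalousDissipation.AnomalousDissipation.Theorems.SolenoidalFractalHomogenisationLagrangianCarrierConstructionOneDirectional
import Summits.AnomalousDissipation.AnomalousDissipation.Theorems.SolenoidalFractalHomogenisationLagrangianCarrierConstructionLevelField
import Summits.AnomalousDissipation.AnomalousDissipation.Theorems.SolenoidalFractalHomogenisationLagrangianCarrierConstructionBookkeepingLevels
import Literature.Analysis.FunctionSpaces.TorusFourierCalculus
import Literature.Analysis.FluidPDE.LagrangianLatticeCarrier
import HarnessLib

/-!
# K3L `LagrangianCarrierConstruction` (stmt-AnomalousDissipation-24913): the r22/r23 form of the stub `stub_flowsL` is FALSE —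
# an explicit permissible one-directional cascade whose (unique) Lagrangian level fields are not pointwise summable

Summits-side file (everything proved; no definitions, no named facts, no `sorry`). NEGATIVE result for the crux chain of
K3L = stmt-AnomalousDissipation-24913 (`Cruxes.LagrangianCarrierConstruction.Birth`, skeletons r22 v3/v4 and r23 v5, stub texts
byte-identical): `stub_flowsL_false : ¬ (registered signature of stub_flowsL)`, verbatim. The registered stub asks
`Permissible → (W1) → (W2) → ∃ E', (same data) ∧ E'.IsLagrangian ∧ E'.LevelRegular`, and `LevelRegular` begins with (R0)
`∀ t x, Summable (fun m => E'.b (m+1) t x)`. For ONE-DIRECTIONAL data (a word all of whose layers are shears `f(x₁) ê₂`) the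
Lagrangian insertion is trivial — `IsLagrangian` forces `b (m+1) = level (m+1)` (`…OneDirectional.b_eq_level_of_oneDirectional`,
no uniqueness theorem for the flow ODE needed: the coarse field takes values in `ker x₁`, so every displacement does, the levels
are invariant under such translations, the coarse flow maps are onto and their derivative kills the levels' direction) — so (R0)
is a property of the bookkeeping DATA, and `Permissible ∧ (W1) ∧ (W2)` does not bound the level amplitudes `a_m/N_m`.

THE WITNESS (all constants explicit, every `Permissible` clause an identity between powers of `3` and `5`): design = the one-slot
Kolmogorov word `exampleWord` (`sin(2π x₁)/(2π) ê₂`, ramp `1/2`), gain `c = 8`, `ν₀ = 2`, `K = 1`, `N_m = 45^m`, `a_m = 225^m`,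
`kbar_m = 9^{-m}`: cell viscosity `≡ 1 < ν₀`, Taylor recursion with constant cell gain `c a²/(kbar² N⁴) = 8 = 9 − 1`, separation
`45 ≥ ⌈K/1⌉`, finer levels viscous-dominated (`kbar_j N_m²/a_m = 9^{m−j} ≥ 1`), physical periods `225^{-m}` (ratio `225`),
`kbar → 0`; refresh windows all equal to `physPeriod 1 = 1/225` ((W1) with `r = 225^m`, (W2) with `q = 1`). At `t₀ = 1/450`
every level `m ≥ 1` sits on the peak of its (triangular) envelope (`225^m t₀ ≡ 1/2 mod 1`, `225` odd) and at `x₀ = (1/180, 0, 0)`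
on the crest of its shear profile (`45^m/180 ≡ 1/4 mod 1`, `45 ≡ 1 mod 4`), so `level (m+1) t₀ x₀ = (5^{m+1}/(2π)) ê₂`
(`cex_level_at`) — not summable. Hence the unique admissible `b` violates (R0): the stub is false AS STATED.

CLASS: stub-misstated, not crux-false — the intended content survives either repair: (a) drop (R0) from the conclusion of
`stub_flowsL` ((R0) lives with the decay clause `a_{m+1} ≤ N_{m+1}^{1−α₀}` of `stub_bookkeepingL`, i.e. in `stub_regularL`'s
hypotheses), or (b) pass `stub_bookkeepingL`'s clauses (S), (T1b), (T4), DEC to `stub_flowsL`. The `IsLagrangian` half of the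
stub together with clauses (L3a), (L4), (F1b), (F2a–c) of `LevelRegular` is PROVED for every datum
(`…FlowsLPeriodic.exists_isLagrangian_periodic`, helpers `…FlowSmooth` … `…TowerPeriodic`), and (L1)/(F1a) per level
(`…TowerLevelContinuity`). A statement about the formal rung F-D1.A0 of route 1 (a frontier FORMAL rung); it says nothing about
anomalous dissipation itself, which is NOT claimed anywhere in this chain.
-/

set_option linter.dupNamespace false

noncomputable section

namespace Summit.AnomalousDissipation.AnomalousDissipation.Theorems.SolenoidalFractalHomogenisation.LagrangianCarrierConstruction

open Set Function Filter Topology MeasureTheory Complex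
open scoped Real
open Literature.Analysis Literature.Analysis.FunctionSpaces Literature.Analysis.FunctionSpaces.Torus
open Literature.Analysis.FluidPDE Literature.Analysis.FluidPDE.LatticeShear
open Summit.AnomalousDissipation.AnomalousDissipation.Theorems.SolenoidalFractalHomogenisation.PermissibleCarrier
  (level_eq_smul carrier_nsmul_apply layer_nsmul_eq mFourier_nsmul)

/-! ## The counterexample bookkeeping: `N_m = 45^m`, `a_m = 225^m`, `kbar_m = 9^{-m}`, gain `8`, `ν₀ = 2`, `K = 1`,
design = the one-slot Kolmogorov word `exampleWord` (`sin(2π x₁) ê₂`, ramp `1/2`) -/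

/-- `(45^m)² = 9^m · 225^m`. [folklore] -/
theorem pow45_sq (m : ℕ) : ((45 : ℝ) ^ m) ^ 2 = 9 ^ m * 225 ^ m := by
  rw [← mul_pow, ← pow_mul, mul_comm, pow_mul]
  norm_num

/-- The cell viscosity of the counterexample cascade is identically `1`. [folklore] -/
theorem cex_cellVisc (D : FractalCarrierData 1) (hN : ∀ m, D.N m = 45 ^ m) (ha : ∀ m, D.a m = 225 ^ m)
    (hκ : ∀ m, D.kbar m = 1 / 9 ^ m) (m : ℕ) : D.cellVisc m = 1 := by
  unfold FractalCarrierData.cellVisc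
  rw [hκ, hN, ha]
  push_cast
  rw [pow45_sq]
  have h9 : (9 : ℝ) ^ m ≠ 0 := pow_ne_zero _ (by norm_num)
  have h225 : (225 : ℝ) ^ m ≠ 0 := pow_ne_zero _ (by norm_num)
  field_simp

/-- Its quasi-static slot stretch is identically `1`. [folklore] -/
theorem cex_slotStretch (D : FractalCarrierData 1) (hN : ∀ m, D.N m = 45 ^ m) (ha : ∀ m, D.a m = 225 ^ m)
    (hκ : ∀ m, D.kbar m = 1 / 9 ^ m) (m : ℕ) : D.slotStretch m = 1 := by
  unfold FractalCarrierData.slotStretch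
  rw [cex_cellVisc D hN ha hκ]
  norm_num

/-- The level-`m` word of a cascade replaying `exampleWord`: period = the slot stretch. [folklore] -/
theorem cex_word_period (D : FractalCarrierData 1) (hW : D.design = exampleWord) (m : ℕ) :
    (D.word m).period = D.slotStretch m := by
  unfold FractalCarrierData.word
  rw [hW]
  simp [LatticeWord.stretch, LatticeWord.period, exampleWord, examplePhase]

/-- … its only slot starts at `0`. [folklore] -/
theorem cex_word_start (D : FractalCarrierData 1) (m : ℕ) (j : Fin 1) : (D.word m).start j = 0 := by
  unfold LatticeWord.start
  have h : Finset.univ.filter (· < j) = (∅ : Finset (Fin 1)) :=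
    Finset.filter_eq_empty_iff.mpr fun i _ h => (lt_irrefl j) (Subsingleton.elim i j ▸ h)
  rw [h, Finset.sum_empty]

/-- … its ramp fraction is `1/2`, its slot duration is the stretch, and its phase has the data of `examplePhase`. [folklore] -/
theorem cex_word_data (D : FractalCarrierData 1) (hW : D.design = exampleWord) (m : ℕ) (j : Fin 1) :
    (D.word m).ramp = 1 / 2 ∧ ((D.word m).phase j).τ = D.slotStretch m * 1 ∧ ((D.word m).phase j).m = examplePhase.m ∧
      ((D.word m).phase j).e = examplePhase.e ∧ ((D.word m).phase j).φ = 0 := by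
  unfold FractalCarrierData.word
  rw [hW]
  simp [LatticeWord.stretch, exampleWord, examplePhase]

/-- The physical period of level `m` is `225^{-m}`. [folklore] -/
theorem cex_physPeriod (D : FractalCarrierData 1) (hW : D.design = exampleWord) (hN : ∀ m, D.N m = 45 ^ m)
    (hκ : ∀ m, D.kbar m = 1 / 9 ^ m) (m : ℕ) : D.physPeriod m = 1 / 225 ^ m := by
  rw [physPeriod_eq, hW, hκ, hN]
  have hper : exampleWord.period = 1 := by simp [LatticeWord.period, exampleWord, examplePhase]
  rw [hper]
  push_cast
  rw [pow45_sq]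
  have h9 : (9 : ℝ) ^ m ≠ 0 := pow_ne_zero _ (by norm_num)
  field_simp

/-- **The counterexample cascade is `Permissible`.** Nested lattices `45^m`, Taylor recursion with constant cell gain `8`
(`kbar_m = 9^{-m}`), quasi-static levels `cellVisc ≡ 1 < 2 = ν₀`, separation `45 ≥ ⌈K/cellVisc⌉ = 1`, finer levels viscous
dominated (`kbar_j N_m²/a_m = 9^{m-j} ≥ 1`), commensurable periods (ratio `225`), `kbar → 0`.
[cite: ArmstrongVicol2025, §3 (3.42)–(3.43) (parameter bookkeeping, transposed)] -/
theorem cex_permissible (D : FractalCarrierData 1) (hW : D.design = exampleWord) (hg : D.gain = 8) (hν : D.nu0 = 2)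
    (hK : D.K = 1) (hN : ∀ m, D.N m = 45 ^ m) (ha : ∀ m, D.a m = 225 ^ m) (hκ : ∀ m, D.kbar m = 1 / 9 ^ m) :
    D.Permissible := by
  refine ⟨by rw [hN]; simp, fun m => ?_, fun m => ?_, fun m => ?_, fun m _ => ?_, fun m => ?_, fun j m hj hjm => ?_,
    fun m => ?_, ?_⟩
  · rw [hN, hN]
    exact pow_dvd_pow 45 (Nat.le_succ m)
  · rw [hN, hN, pow_succ]
    calc 2 * 45 ^ m ≤ 45 * 45 ^ m := Nat.mul_le_mul_right _ (by norm_num)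
      _ = 45 ^ m * 45 := by ring
  · -- Taylor recursion with constant cell gain `8`
    rw [hκ, hκ, hg, ha, hN]
    push_cast
    obtain ⟨X, hX⟩ : ∃ X : ℝ, X = 9 ^ m := ⟨_, rfl⟩
    obtain ⟨Y, hY⟩ : ∃ Y : ℝ, Y = 5 ^ (m + 1) := ⟨_, rfl⟩
    have hX0 : 0 < X := by rw [hX]; positivity
    have hY0 : 0 < Y := by rw [hY]; positivity
    have h45 : (45 : ℝ) ^ (m + 1) = 9 * X * Y := by
      rw [hX, hY, show (45 : ℝ) = 9 * 5 by norm_num, mul_pow, pow_succ]; ring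
    have h225 : (225 : ℝ) ^ (m + 1) = 9 * X * Y ^ 2 := by
      rw [hX, hY, ← pow_mul, show (225 : ℝ) = 9 * 5 ^ 2 by norm_num, mul_pow, ← pow_mul, pow_succ]; ring_nf
    have h9 : (9 : ℝ) ^ (m + 1) = X * 9 := by rw [hX, pow_succ]
    rw [h45, h225, h9, ← hX]
    field_simp
    ring
  · rw [cex_cellVisc D hN ha hκ, hν]
    norm_num
  · rw [hK, cex_cellVisc D hN ha hκ, hN, hN, div_one, Nat.ceil_one]
    push_cast
    rw [one_mul, pow_succ]
    exact le_mul_of_one_le_right (by positivity) (by norm_num)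
  · rw [hκ, hN, ha]
    push_cast
    rw [pow45_sq]
    have h9j : (0 : ℝ) < 9 ^ j := by positivity
    have h225 : (0 : ℝ) < 225 ^ m := by positivity
    rw [one_le_div (by positivity), one_div, inv_mul_eq_div]
    have hle : (9 : ℝ) ^ j ≤ 9 ^ m := pow_le_pow_right₀ (by norm_num) hjm.le
    calc (225 : ℝ) ^ m = 1 * 225 ^ m := (one_mul _).symm
      _ ≤ (9 ^ m / 9 ^ j) * 225 ^ m := by
          refine mul_le_mul_of_nonneg_right ?_ h225.le
          rwa [le_div_iff₀ h9j, one_mul]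
      _ = 9 ^ m * 225 ^ m / 9 ^ j := by ring
  · refine ⟨225, by norm_num, ?_⟩
    rw [cex_physPeriod D hW hN hκ, cex_physPeriod D hW hN hκ, pow_succ]
    push_cast
    have h225 : (225 : ℝ) ^ m ≠ 0 := pow_ne_zero _ (by norm_num)
    field_simp
  · have hfun : D.kbar = fun m => (1 / 9 : ℝ) ^ m := funext fun m => by rw [hκ, one_div_pow]
    rw [hfun]
    exact tendsto_pow_atTop_nhds_zero_of_lt_one (by norm_num) (by norm_num)

/-! ## The levels of a cascade replaying `exampleWord`: shears `c • ê₂` depending on `x₁` only -/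

/-- The lattice normal of `examplePhase` is the first basis vector. [folklore] -/
theorem latticeVec_examplePhase : latticeVec examplePhase.m = EuclideanSpace.single 0 (1 : ℝ) := by
  ext i
  rw [latticeVec_apply, PiLp.single_apply]
  simp only [examplePhase]
  split_ifs <;> simp

/-- **Master formula.** Every level of a cascade replaying `exampleWord` is an explicit scalar multiple of `ê₂ = single 1 1`:
`level m t x = (a_m/N_m) · env_m(t) · Im e_{(1,0,0)}(N_m • x)/(2π) · ê₂`. [cite: ArmstrongVicol2025, §3 (alternating-shear fractal carrier)] -/
theorem cex_level_eq (D : FractalCarrierData 1) (hW : D.design = exampleWord) (m : ℕ) (t : ℝ) (x : UnitAddTorus (Fin 3)) :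
    D.level m t x = (D.a m / (D.N m : ℝ) * (LatticeWord.trapezoid 0 (D.slotStretch m * 1) (1 / 2)
      (Int.fract (D.a m * t / (D.word m).period) * (D.word m).period) *
        ((UnitAddTorus.mFourier examplePhase.m (D.N m • x)).im / (2 * π)))) • EuclideanSpace.single 1 (1 : ℝ) := by
  obtain ⟨hramp, hτ, hm, he, hφ⟩ := cex_word_data D hW m 0
  rw [level_eq_smul, Pi.smul_apply, carrier_nsmul_apply, Fin.sum_univ_one, cex_word_start, hramp, hτ, LatticePhase.layer,
    hm, he, hφ, latticeVec_examplePhase, PiLp.norm_single, norm_one, mul_one, smul_smul, smul_smul]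
  congr 1
  simp only [examplePhase, Complex.ofReal_zero, zero_mul, Complex.exp_zero, mul_one, one_div]
  ring

/-- The first coordinate functional kills every level. [folklore] -/
theorem cex_level_ker (D : FractalCarrierData 1) (hW : D.design = exampleWord) (m : ℕ) (t : ℝ) (x : UnitAddTorus (Fin 3)) :
    EuclideanSpace.proj (0 : Fin 3) (D.level m t x) = 0 := by
  rw [cex_level_eq D hW]
  simp

/-- The character `e_{(1,0,0)}` is invariant under torus translations by `proj d` with `d₁ = 0`, at every lattice scale. [folklore] -/
theorem mFourier_examplePhase_nsmul_add (N : ℕ) (x : UnitAddTorus (Fin 3)) (d : EuclideanSpace ℝ (Fin 3)) (hd : d 0 = 0) :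
    UnitAddTorus.mFourier examplePhase.m (N • (x + proj d)) = UnitAddTorus.mFourier examplePhase.m (N • x) := by
  rw [smul_add, mFourier_apply_add, mFourier_nsmul _ _ (proj d)]
  have h1 : UnitAddTorus.mFourier (fun i => examplePhase.m i * (N : ℤ)) (proj d) = 1 := by
    simp [UnitAddTorus.mFourier, proj_apply, Fin.prod_univ_three, examplePhase, hd]
  rw [h1, mul_one]

/-- Every level is invariant under the torus translations by `proj d`, `d₁ = 0` (the kernel of the first coordinate). [folklore] -/
theorem cex_level_inv (D : FractalCarrierData 1) (hW : D.design = exampleWord) (m : ℕ) (t : ℝ) (x : UnitAddTorus (Fin 3))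
    (d : EuclideanSpace ℝ (Fin 3)) (hd : EuclideanSpace.proj (0 : Fin 3) d = 0) :
    D.level m t (x + proj d) = D.level m t x := by
  rw [cex_level_eq D hW, cex_level_eq D hW, mFourier_examplePhase_nsmul_add _ _ _ hd]

/-! ## Resonance: at `t₀ = 1/450`, `x₀ = (1/180, 0, 0)` every level is on its envelope peak and its shear crest -/

/-- `45^m ≡ 1 (mod 4)`. [folklore] -/
theorem pow45_mod_four (m : ℕ) : ∃ q : ℕ, 45 ^ m = 4 * q + 1 := by
  have h : 45 ^ m % 4 = 1 := by
    rw [Nat.pow_mod]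
    simp
  exact ⟨45 ^ m / 4, by have := Nat.div_add_mod (45 ^ m) 4; omega⟩

/-- `225^m` is odd. [folklore] -/
theorem pow225_odd (m : ℕ) : ∃ q : ℕ, 225 ^ m = 2 * q + 1 := by
  have h : 225 ^ m % 2 = 1 := by
    rw [Nat.pow_mod]
    simp
  exact ⟨225 ^ m / 2, by have := Nat.div_add_mod (225 ^ m) 2; omega⟩

/-- The crest value of the character: `e_{(1,0,0)}(45^{m+1} • (1/180, 0, 0)) = exp(2πi · 45^m/4) = i`. [folklore] -/
theorem mFourier_examplePhase_crest (m : ℕ) :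
    (UnitAddTorus.mFourier examplePhase.m ((45 ^ (m + 1) : ℕ) • proj ((1 / 180 : ℝ) • EuclideanSpace.single 0 (1 : ℝ)))).im
      = 1 := by
  rw [mFourier_nsmul, mFourier_proj_smul_single, fourier_coe_apply]
  obtain ⟨q, hq⟩ := pow45_mod_four m
  have hq' : (45 : ℂ) ^ m = 4 * q + 1 := by exact_mod_cast hq
  have hexp : (2 * π * I * ((examplePhase.m 0 * ((45 ^ (m + 1) : ℕ) : ℤ) : ℤ) : ℂ) * ((1 / 180 : ℝ) : ℂ) / ((1 : ℝ) : ℂ)) =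
      (q : ℂ) * (2 * π * I) + π / 2 * I := by
    simp only [examplePhase, if_true, one_mul]
    push_cast
    rw [pow_succ, hq']
    ring
  rw [hexp, Complex.exp_add, exp_nat_mul_two_pi_mul_I, exp_pi_div_two_mul_I, one_mul, Complex.I_im]

/-- **Every level at the resonance point:** `level (m+1) (1/450) (1/180, 0, 0) = (5^{m+1}/(2π)) ê₂`. [folklore] -/
theorem cex_level_at (D : FractalCarrierData 1) (hW : D.design = exampleWord) (hN : ∀ m, D.N m = 45 ^ m)
    (ha : ∀ m, D.a m = 225 ^ m) (hκ : ∀ m, D.kbar m = 1 / 9 ^ m) (m : ℕ) :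
    D.level (m + 1) (1 / 450) (proj ((1 / 180 : ℝ) • EuclideanSpace.single 0 (1 : ℝ))) =
      ((5 : ℝ) ^ (m + 1) / (2 * π)) • EuclideanSpace.single 1 (1 : ℝ) := by
  rw [cex_level_eq D hW, cex_word_period D hW, cex_slotStretch D hN ha hκ, hN, mFourier_examplePhase_crest, ha]
  obtain ⟨q, hq⟩ := pow225_odd m
  have hq' : (225 : ℝ) ^ m = 2 * q + 1 := by exact_mod_cast hq
  have hfr : Int.fract ((225 : ℝ) ^ (m + 1) * (1 / 450) / 1) = 1 / 2 := by
    rw [pow_succ, hq', show ((2 : ℝ) * q + 1) * 225 * (1 / 450) / 1 = (q : ℝ) + 1 / 2 by ring, Int.fract_natCast_add]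
    exact Int.fract_eq_self.mpr ⟨by norm_num, by norm_num⟩
  rw [hfr]
  have htrap : LatticeWord.trapezoid 0 (1 * 1) (1 / 2) (1 / 2 * 1) = 1 := by
    norm_num [LatticeWord.trapezoid]
  rw [htrap]
  push_cast
  rw [← div_pow, show (225 : ℝ) / 45 = 5 by norm_num]
  ring

/-- **The levels are not pointwise summable at the resonance point** (their norms are `5^{m+1}/(2π) ≥ 5/(2π)`). [folklore] -/
theorem cex_not_summable (D : FractalCarrierData 1) (hW : D.design = exampleWord) (hN : ∀ m, D.N m = 45 ^ m)
    (ha : ∀ m, D.a m = 225 ^ m) (hκ : ∀ m, D.kbar m = 1 / 9 ^ m) :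
    ¬ Summable fun m => D.level (m + 1) (1 / 450) (proj ((1 / 180 : ℝ) • EuclideanSpace.single 0 (1 : ℝ))) := by
  intro hs
  have ht := hs.tendsto_atTop_zero.norm
  rw [norm_zero] at ht
  have hpos : (0 : ℝ) < 5 / (2 * π) := by positivity
  obtain ⟨m, hm⟩ := (ht.eventually_lt_const hpos).exists
  rw [cex_level_at D hW hN ha hκ, norm_smul, PiLp.norm_single, norm_one, mul_one, Real.norm_eq_abs,
    abs_of_pos (by positivity)] at hm
  have hle : (5 : ℝ) / (2 * π) ≤ 5 ^ (m + 1) / (2 * π) := by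
    refine div_le_div_of_nonneg_right ?_ (by positivity)
    calc (5 : ℝ) = 5 ^ 1 := (pow_one _).symm
      _ ≤ 5 ^ (m + 1) := pow_le_pow_right₀ (by norm_num) (by omega)
  linarith

/-! ## The refutation -/

/-- **The r22/r23 form of the registered stub `stub_flowsL` is false.** The stub (skeletons v3–v5 of
`Cruxes.LagrangianCarrierConstruction.Birth`, sha16 `fedb8f2dd8674275` / `32a73529f3fe0b40`) asks, for EVERY Lagrangian lattice
carrier datum `E` with `Permissible` bookkeeping and commensurable refresh windows (W1), (W2), for level fields / displacements
`E'` over the same data with `E'.IsLagrangian ∧ E'.LevelRegular`; but clause (R0) of `LevelRegular` — pointwise summability of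
`m ↦ b (m+1) t x` — is a property of the DATA once `IsLagrangian` holds, and `Permissible ∧ (W1) ∧ (W2)` does not bound the
level amplitudes `a_m/N_m`. Witness: the one-slot Kolmogorov word `exampleWord` (`sin(2π x₁) ê₂`), gain `8`, `ν₀ = 2`, `K = 1`,
`N_m = 45^m`, `a_m = 225^m`, `kbar_m = 9^{-m}` (`Permissible`: `cex_permissible`), refresh windows all equal to `physPeriod 1 =
1/225`; its levels are shears along `ê₂` depending on `x₁` only, so `IsLagrangian` forces `b (m+1) = level (m+1)`
(`b_eq_level_of_oneDirectional`), and at `t₀ = 1/450`, `x₀ = (1/180, 0, 0)` one has `‖level (m+1) t₀ x₀‖ = 5^{m+1}/(2π)`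
(`cex_level_at`), not summable. Class: stub-misstated (repair: drop (R0) from the conclusion of `stub_flowsL`, or pass the
decay / strain clauses of `stub_bookkeepingL` to it); the `IsLagrangian` half and clauses (L3a), (L4), (F1b), (F2) of the stub are
PROVED (`exists_isLagrangian_periodic`). A statement about the formal rung F-D1.A0 of route 1 (frontier FORMAL rung); nothing
here bears on anomalous dissipation itself. [cite: ArmstrongVicol2025, §2.2 (PDF p. 18) and §3 (3.42)–(3.43)] -/
theorem stub_flowsL_false : ¬ (∀ k (E : LagrangianLatticeCarrier k), E.toFractalCarrierData.Permissible →
    (∀ m, ∃ r : ℕ, 0 < r ∧ E.refresh (m + 1) = (r : ℝ) * E.toFractalCarrierData.physPeriod (m + 1)) →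
    (∀ m, ∃ q : ℕ, 0 < q ∧ E.refresh m = (q : ℝ) * E.refresh (m + 1)) →
    ∃ E' : LagrangianLatticeCarrier k, E'.toFractalCarrierData = E.toFractalCarrierData ∧ E'.refresh = E.refresh ∧
      E'.θ = E.θ ∧ E'.IsLagrangian ∧ E'.LevelRegular) := by
  intro h
  obtain ⟨D, hW, hg, hν, hK, hN, ha, hκ⟩ : ∃ D : FractalCarrierData 1, D.design = exampleWord ∧ D.gain = 8 ∧ D.nu0 = 2 ∧
      D.K = 1 ∧ (∀ m, D.N m = 45 ^ m) ∧ (∀ m, D.a m = 225 ^ m) ∧ (∀ m, D.kbar m = 1 / 9 ^ m) :=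
    ⟨⟨exampleWord, 8, 2, 1, fun m => 45 ^ m, fun m => 225 ^ m, fun m => 1 / 9 ^ m, by norm_num, by norm_num, by norm_num,
      fun m => pow_pos (by norm_num) m, fun m => pow_pos (by norm_num) m, fun m => by positivity⟩,
      rfl, rfl, rfl, rfl, fun _ => rfl, fun _ => rfl, fun _ => rfl⟩
  obtain ⟨E, hED, hER⟩ : ∃ E : LagrangianLatticeCarrier 1, E.toFractalCarrierData = D ∧ E.refresh = fun _ => 1 / 225 :=
    ⟨⟨D, fun _ => 1 / 225, fun _ => 1, fun _ _ _ => 0, fun _ _ _ _ => 0, fun _ => by norm_num, fun _ => by norm_num⟩,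
      rfl, rfl⟩
  have hP : E.toFractalCarrierData.Permissible := by
    rw [hED]
    exact cex_permissible D hW hg hν hK hN ha hκ
  have hW1 : ∀ m, ∃ r : ℕ, 0 < r ∧ E.refresh (m + 1) = (r : ℝ) * E.toFractalCarrierData.physPeriod (m + 1) := by
    intro m
    refine ⟨225 ^ m, pow_pos (by norm_num) m, ?_⟩
    rw [hED, hER, cex_physPeriod D hW hN hκ, pow_succ]
    push_cast
    have h225 : (225 : ℝ) ^ m ≠ 0 := pow_ne_zero _ (by norm_num)
    field_simp
  have hW2 : ∀ m, ∃ q : ℕ, 0 < q ∧ E.refresh m = (q : ℝ) * E.refresh (m + 1) := fun m =>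
    ⟨1, one_pos, by rw [hER]; simp⟩
  obtain ⟨E', hdata, -, -, hLag, hReg⟩ := h 1 E hP hW1 hW2
  rw [hED] at hdata
  have hb : ∀ m t x, E'.b (m + 1) t x = D.level (m + 1) t x := by
    intro m t x
    have hker : ∀ m t x, EuclideanSpace.proj (0 : Fin 3) (E'.toFractalCarrierData.level m t x) = 0 := by
      rw [hdata]
      exact cex_level_ker D hW
    have hinv : ∀ m t x (d : EuclideanSpace ℝ (Fin 3)), EuclideanSpace.proj (0 : Fin 3) d = 0 →
        E'.toFractalCarrierData.level m t (x + proj d) = E'.toFractalCarrierData.level m t x := by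
      rw [hdata]
      exact cex_level_inv D hW
    have h1 := b_eq_level_of_oneDirectional E' (EuclideanSpace.proj (0 : Fin 3)) hker hinv hLag m t x
    rw [hdata] at h1
    exact h1
  have hsum := hReg.1 (1 / 450) (proj ((1 / 180 : ℝ) • EuclideanSpace.single 0 (1 : ℝ)))
  exact cex_not_summable D hW hN ha hκ (hsum.congr fun m => hb m _ _)

end Summit.AnomalousDissipation.AnomalousDissipation.Theorems.SolenoidalFractalHomogenisation.LagrangianCarrierConstruction

end
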